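import Summits.CriticalPhenomena.SAWScalingLimit.Theorems.SAWDevelopingMapHexTightDiveRecursion
import Summits.CriticalPhenomena.SAWScalingLimit.Theorems.DefectDecoherence.Negative.WallExitTwoPoint
import Literature.Probability.RandomPlanarGeometry.PolylineShellTraversals
import HarnessLib

/-!
# Traversal localization (stub `stub_travLocalization`, line `reversal-virgin-disc`, `HexTight`)

Crux `stmt-CriticalPhenomena-5423` (`…Theses.SAWResidueField.HexTight`, verbatim
`…SAWDevelopingMap.HexTight`: eventual tightness of the critical hexagonal-lattice SAW laws), line
`reversal-virgin-disc`,
registered stub `stub_travLocalization` (`= VertexToCurve → TravLocalization` of the skeleton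
`Cruxes/HexTight/Lines/reversal_virgin_disc.lean`, r5), over the objects of
`…Theorems.SAWDevelopingMapHexTightReversalDefs` (`IsHArc`, `arcCurve`, `arcMass`, `travMass`,
`Straddles`, `IsVirgin`).

**Statement.** Assume `VertexToCurve` (weak vertex traversals of `D(x; r, R)` by a list of points
⇒ separate traversals of every strictly shrunk shell by its polyline; proved separately). Let
`(H, Λ₀)` be virgin at radius `r₁` about any centre `y`, the arc class running between the
mid-edges `{u, c}`, `{u', c'}` with `u, u' ∉ Λ₀` lattice-adjacent to `c, c'` and strictly outside
the `r₁`-circle, `0 ≤ ρ`, `ρ + 4 < R`, `R + 2 ≤ r₁`, `k ≥ 1`. If every virgin sub-configuration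
`(H, Λ' ⊆ Λ₀)` at `(y, r₁)` with doors `m, m'` has `k`-traversal ratio `≤ θ` for
`D(y; ρ + 2, R - 2)`, then the class has `k`-traversal ratio `≤ θ` for `D(y; ρ, R)`.

**Proof** (the landed `stub_diveRecursion` re-centred, "`k` separate traversals" replacing
"dives"). An `H`-arc with `k ≥ 1` traversals of `D(y; ρ, R)` has a vertex in `B̄(y, r₁)`
(`exists_mem_verts_of_hasTraversals`: consecutive points of its polyline are `≤ 1` apart).
Group these arcs by (prefix before the first vertex in `B̄(y, r₁)`, it, the last such vertex,
suffix) as in `stub_diveRecursion`; on a group the connector map is a weight-shifting bijection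
onto the `H`-arcs of the reduced domain between two doors at radius `r₁`
(`diveRecursion_fiber_sum_eq`) which TRANSFERS the event (`hasTraversals_cut`, via
`vertexTraversals_of_hasTraversals_polyline`, `vertexTraversals_middle`,
`vertexTraversals_cons_append_singleton`, `VertexToCurve`); the reduced configuration is virgin,
so the hypothesis bounds each group (`travLocalization_fiber_bound`); sum over the groups.
Sources: M. Aizenman, A. Burchard, Duke Math. J. 99 (1999) §1.b, §3.a; N. Madras, G. Slade,
*The Self-Avoiding Walk* (1993) §3–4. Sorry-free, standard axioms only.
-/

noncomputable section

namespace Summit.CriticalPhenomena.SAWScalingLimit.Theorems.HexTight.Reversal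

open scoped BigOperators Classical
open Literature.Probability.LatticeModels Literature.Probability.RandomPlanarGeometry
  Literature.Probability.RandomPlanarGeometry.SAW
open Summit.CriticalPhenomena.SAWScalingLimit.Cruxes.DefectDecoherence.TipMartingaleDepthInduction.WallExitTwoPoint
  (dist_hexCenter_le_one_of_adj)

/-! ### Lattice geometry: mid-edges are within `1/2` of their ends (adjacent centres are `≤ 1`
apart, `dist_hexCenter_le_one_of_adj` of `Theorems/DefectDecoherence/Negative/WallExitTwoPoint`) -/

/-- The mid-edge point of `{u, c}` is within `1/2` of the centre of `c` (`u ∼ c`). -/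
theorem dist_hexMidpoint_hexCenter_le_half {u c : HexVertex} (h : hexGraph.Adj u c) :
    dist (hexMidpoint s(u, c)) (hexCenter c) ≤ 1 / 2 := by
  have e : hexMidpoint s(u, c) - hexCenter c = (2 : ℂ)⁻¹ * (hexCenter u - hexCenter c) := by
    rw [hexMidpoint_mk]; ring
  rw [dist_eq_norm, e, norm_mul, norm_inv, Complex.norm_two, ← dist_eq_norm]
  linarith [dist_hexCenter_le_one_of_adj h.symm]

/-- The mid-edge point of `{u, c}` is at least `dist(c(u), y) - 1/2` away from any point `y`. -/
theorem dist_hexCenter_sub_half_le_dist_hexMidpoint {u c : HexVertex} (h : hexGraph.Adj u c)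
    (y : ℂ) : dist (hexCenter u) y - 1 / 2 ≤ dist (hexMidpoint s(u, c)) y := by
  have h1 : dist (hexCenter u) (hexMidpoint s(u, c)) ≤ 1 / 2 := by
    rw [Sym2.eq_swap, dist_comm]; exact dist_hexMidpoint_hexCenter_le_half h.symm
  linarith [dist_triangle (hexCenter u) (hexMidpoint s(u, c)) y]

/-- Consecutive points of the polyline `mid{u,c}, c(v₁), …, c(vₙ), mid{u',c'}` of an arc between
the doors `{u, c}`, `{u', c'}` (`u, u' ∉ Λ`, `u ∼ c`, `u' ∼ c'`) are at distance `≤ 1`. -/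
theorem isChain_dist_points {Λ : Finset HexVertex} {u c u' c' : HexVertex}
    (γ : HexMidEdgeSAW Λ s(u, c) s(u', c')) (hu : u ∉ Λ) (hu' : u' ∉ Λ)
    (huc : hexGraph.Adj u c) (huc' : hexGraph.Adj u' c') :
    List.IsChain (fun p q : ℂ => dist p q ≤ 1) γ.points := by
  have hR : List.IsChain (fun p q : ℂ => dist p q ≤ 1) (γ.verts.map hexCenter) :=
    List.isChain_map_of_isChain hexCenter (fun a b h => dist_hexCenter_le_one_of_adj h.symm)
      γ.isChain
  by_cases hne : γ.verts = []
  · have haz : s(u, c) = s(u', c') := γ.eq_of_nil hne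
    show List.IsChain _ (hexMidpoint s(u, c) :: γ.verts.map hexCenter ++ [hexMidpoint s(u', c')])
    rw [hne, ← haz]
    simp
  · have hh := γ.head?_eq_of_door rfl hu hne
    have hl := γ.getLast?_eq_of_door rfl hu' hne
    have h2 : List.IsChain (fun p q : ℂ => dist p q ≤ 1)
        (γ.verts.map hexCenter ++ [hexMidpoint s(u', c')]) := by
      refine hR.append (List.isChain_singleton _) fun p hp q hq => ?_
      rw [Option.mem_def, List.getLast?_map, hl, Option.map_some, Option.some.injEq] at hp
      rw [Option.mem_def, List.head?_cons, Option.some.injEq] at hq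
      rw [← hp, ← hq, dist_comm]
      exact (dist_hexMidpoint_hexCenter_le_half huc').trans (by norm_num)
    refine (h2.cons fun q hq => ?_ : List.IsChain (fun p q : ℂ => dist p q ≤ 1)
      (hexMidpoint s(u, c) :: (γ.verts.map hexCenter ++ [hexMidpoint s(u', c')])))
    rw [Option.mem_def, List.head?_append, List.head?_map, hh, Option.map_some, Option.some_or,
      Option.some.injEq] at hq
    rw [← hq]
    exact (dist_hexMidpoint_hexCenter_le_half huc).trans (by norm_num)

/-- **An arc with `k ≥ 1` separate traversals of `D(y; ρ, R)` has a vertex in `B̄(y, r₁)`**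
(`ρ + 4 < R ≤ r₁ - 2`, both outer door vertices strictly outside the `r₁`-circle): some point of
its point list is within `ρ + 1` of `y`, and it is not one of the two end mid-points. -/
theorem exists_mem_verts_of_hasTraversals {Λ : Finset HexVertex} {u c u' c' : HexVertex}
    (γ : HexMidEdgeSAW Λ s(u, c) s(u', c')) (hu : u ∉ Λ) (hu' : u' ∉ Λ)
    (huc : hexGraph.Adj u c) (huc' : hexGraph.Adj u' c') {y : ℂ} {ρ R r₁ : ℝ} {k : ℕ}
    (hk : 1 ≤ k) (hρR : ρ + 4 < R) (hRr : R + 2 ≤ r₁)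
    (hyu : r₁ < dist (hexCenter u) y) (hyu' : r₁ < dist (hexCenter u') y)
    (h : (arcCurve γ).HasTraversals k y ρ R) :
    ∃ v ∈ γ.verts, dist (hexCenter v) y ≤ r₁ := by
  have hvt := vertexTraversals_of_hasTraversals_polyline (a := hexMidpoint s(u, c))
    (l := γ.verts.map hexCenter ++ [hexMidpoint s(u', c')]) zero_le_one
    (isChain_dist_points γ hu hu' huc huc') h
  obtain ⟨q, hq, hqy⟩ := exists_dist_le_of_vertexTraversals hvt hk
  rcases List.mem_cons.1 hq with rfl | hq
  · linarith [dist_hexCenter_sub_half_le_dist_hexMidpoint huc y]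
  · rcases List.mem_append.1 hq with hq | hq
    · obtain ⟨v, hv, rfl⟩ := List.mem_map.1 hq
      exact ⟨v, hv, by linarith⟩
    · rw [List.mem_singleton.1 hq] at hqy
      linarith [dist_hexCenter_sub_half_le_dist_hexMidpoint huc' y]

/-- **Transfer.** Assume `VertexToCurve`. Let the arc `γ` between the doors `{u, c}`, `{u', c'}`
(outer vertices strictly outside the `r₁`-circle about `y`) be glued from a connector `δ` (from
`c₁` to `c_L`, both `≥ R - 1` away from `y`) and blocks `β`, `β'` strictly outside that circle,
`ρ + 4 < R ≤ r₁ - 2`. Then `k` separate traversals of `D(y; ρ, R)` by the polyline of `γ` give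
`k` separate traversals of `D(y; ρ + 2, R - 2)` by the polyline of `δ`. -/
theorem hasTraversals_cut
    (hVC : ∀ (l : List ℂ) (k : ℕ) (x : ℂ) (r r' R' R : ℝ), r < r' → r' < R' → R' < R →
      (∃ ι κ : Fin k → Fin l.length, (∀ m, ι m ≤ κ m) ∧
        (∀ m, (dist (l.get (ι m)) x ≤ r ∧ R ≤ dist (l.get (κ m)) x) ∨
          (R ≤ dist (l.get (ι m)) x ∧ dist (l.get (κ m)) x ≤ r)) ∧
        ∀ ⦃m m'⦄, m < m' → κ m ≤ ι m') →
      (⟨polyline l⟩ : Curve ℂ).HasTraversals k x r' R')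
    {Λ Λ' : Finset HexVertex} {u c u' c' p p' c₁ c₂ : HexVertex}
    (γ : HexMidEdgeSAW Λ s(u, c) s(u', c')) (δ : HexMidEdgeSAW Λ' s(p, c₁) s(p', c₂))
    {β β' : List HexVertex} (hγv : γ.verts = β ++ δ.verts ++ β')
    (hh : δ.verts.head? = some c₁) (hl : δ.verts.getLast? = some c₂)
    (hu : u ∉ Λ) (hu' : u' ∉ Λ) (huc : hexGraph.Adj u c) (huc' : hexGraph.Adj u' c')
    {y : ℂ} {ρ R r₁ : ℝ} {k : ℕ} (hρR : ρ + 4 < R) (hRr : R + 2 ≤ r₁)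
    (hyu : r₁ < dist (hexCenter u) y) (hyu' : r₁ < dist (hexCenter u') y)
    (hβ : ∀ v ∈ β, r₁ < dist (hexCenter v) y) (hβ' : ∀ v ∈ β', r₁ < dist (hexCenter v) y)
    (hc₁ : R - 1 ≤ dist (hexCenter c₁) y) (hc₂ : R - 1 ≤ dist (hexCenter c₂) y)
    (h : (arcCurve γ).HasTraversals k y ρ R) :
    (arcCurve δ).HasTraversals k y (ρ + 2) (R - 2) := by
  have hch := isChain_dist_points γ hu hu' huc huc'
  -- `k` weak vertex traversals of `D(y; ρ + 1, R - 1)` by the point list of `γ`, then by the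
  -- middle block, then with the connector's two end mid-points, then `VertexToCurve`
  have hvt := vertexTraversals_of_hasTraversals_polyline (a := hexMidpoint s(u, c))
    (l := (β ++ δ.verts ++ β').map hexCenter ++ [hexMidpoint s(u', c')]) (k := k) (x := y)
    (r := ρ) (R := R) zero_le_one (by rw [← hγv]; exact hch) (by rw [← hγv]; exact h)
  have hsplit : hexMidpoint s(u, c) :: ((β ++ δ.verts ++ β').map hexCenter ++
      [hexMidpoint s(u', c')]) = (hexMidpoint s(u, c) :: β.map hexCenter) ++
        δ.verts.map hexCenter ++ (β'.map hexCenter ++ [hexMidpoint s(u', c')]) := by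
    simp only [List.map_append, List.cons_append, List.append_assoc]
  rw [hsplit] at hvt
  have hne : δ.verts.map hexCenter ≠ [] := fun h0 => by
    rw [List.map_eq_nil_iff.1 h0] at hh; exact absurd hh (by simp)
  have hhead : (δ.verts.map hexCenter).head hne = hexCenter c₁ := by
    rw [List.head_eq_iff_head?_eq_some, List.head?_map, hh, Option.map_some]
  have hlast : (δ.verts.map hexCenter).getLast hne = hexCenter c₂ := by
    rw [List.getLast_eq_iff_getLast?_eq_some, List.getLast?_map, hl, Option.map_some]
  have hmid := vertexTraversals_middle hne hvt ?_ ?_ (by rw [hhead]; exact hc₁)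
    (by rw [hlast]; exact hc₂)
  rotate_left
  · intro q hq
    rcases List.mem_cons.1 hq with rfl | hq
    · linarith [dist_hexCenter_sub_half_le_dist_hexMidpoint huc y]
    · obtain ⟨v, hv, rfl⟩ := List.mem_map.1 hq
      linarith [hβ v hv]
  · intro q hq
    rcases List.mem_append.1 hq with hq | hq
    · obtain ⟨v, hv, rfl⟩ := List.mem_map.1 hq
      linarith [hβ' v hv]
    · rw [List.mem_singleton.1 hq]
      linarith [dist_hexCenter_sub_half_le_dist_hexMidpoint huc' y]
  exact hVC _ k y (ρ + 1) (ρ + 2) (R - 2) (R - 1) (by linarith) (by linarith) (by linarith)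
    (vertexTraversals_cons_append_singleton hmid (hexMidpoint s(p, c₁)) (hexMidpoint s(p', c₂)))

/-- **One group of the traversal localization.** Assume `VertexToCurve`. In a configuration
virgin at `(y, r₁)` with door-type ends `{u, c}`, `{u', c'}` (`u, u'` strictly outside the
`r₁`-circle), fix a model `H`-arc `γ₀ = β ++ α₀ ++ β'` cut at its first and last vertices `c₁`,
`c_L` in `B̄(y, r₁)` (`β`, `β'` strictly outside). Over the group `A` of `H`-arcs `β ++ α ++ β'`
with `α` from `c₁` to `c_L`, the mass of the arcs with `k` separate traversals of `D(y; ρ, R)` is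
at most `θ` times the mass, `θ` being the `k`-traversal ratio bound for `D(y; ρ + 2, R - 2)` of
the reduced configuration (virgin at `(y, r₁)`, the two new mid-edges being doors). -/
theorem travLocalization_fiber_bound
    (hVC : ∀ (l : List ℂ) (k : ℕ) (x : ℂ) (r r' R' R : ℝ), r < r' → r' < R' → R' < R →
      (∃ ι κ : Fin k → Fin l.length, (∀ m, ι m ≤ κ m) ∧
        (∀ m, (dist (l.get (ι m)) x ≤ r ∧ R ≤ dist (l.get (κ m)) x) ∨
          (R ≤ dist (l.get (ι m)) x ∧ dist (l.get (κ m)) x ≤ r)) ∧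
        ∀ ⦃m m'⦄, m < m' → κ m ≤ ι m') →
      (⟨polyline l⟩ : Curve ℂ).HasTraversals k x r' R')
    {H : SimpleGraph HexVertex} {Λ : Finset HexVertex} {y : ℂ} {r₁ ρ R θ : ℝ} {k : ℕ}
    {u c u' c' : HexVertex} (hρR : ρ + 4 < R) (hRr : R + 2 ≤ r₁)
    (hV : IsVirgin H Λ y r₁) (huc : hexGraph.Adj u c) (hu : u ∉ Λ)
    (hyu : r₁ < dist (hexCenter u) y) (huc' : hexGraph.Adj u' c') (hu' : u' ∉ Λ)
    (hyu' : r₁ < dist (hexCenter u') y)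
    (hrec : ∀ (Λ' : Finset HexVertex) (m m' : Sym2 HexVertex), Λ' ⊆ Λ →
      IsVirgin H Λ' y r₁ → Straddles Λ' y r₁ m → Straddles Λ' y r₁ m' →
      travMass H Λ' m m' k y (ρ + 2) (R - 2) ≤ θ * arcMass H Λ' m m')
    (γ₀ : HexMidEdgeSAW Λ s(u, c) s(u', c')) (h₀ : IsHArc H γ₀)
    {β α₀ β' : List HexVertex} {c₁ c₂ : HexVertex}
    (hdec : γ₀.verts = β ++ α₀ ++ β') (hh₀ : α₀.head? = some c₁) (hl₀ : α₀.getLast? = some c₂)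
    (hc₁ : dist (hexCenter c₁) y ≤ r₁) (hc₂ : dist (hexCenter c₂) y ≤ r₁)
    (hβ : ∀ v ∈ β, r₁ < dist (hexCenter v) y) (hβ' : ∀ v ∈ β', r₁ < dist (hexCenter v) y)
    (A : Finset (HexMidEdgeSAW Λ s(u, c) s(u', c')))
    (hA : ∀ γ, γ ∈ A ↔ IsHArc H γ ∧
      ∃ α, γ.verts = β ++ α ++ β' ∧ α.head? = some c₁ ∧ α.getLast? = some c₂) :
    ∑ γ ∈ A, (if (arcCurve γ).HasTraversals k y ρ R then hexCriticalFugacity ^ γ.length else 0) ≤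
      θ * ∑ γ ∈ A, hexCriticalFugacity ^ γ.length := by
  obtain ⟨I, p, hp⟩ : ∃ I p, u :: β = I ++ [p] :=
    ⟨_, _, (List.dropLast_concat_getLast (List.cons_ne_nil u β)).symm⟩
  obtain ⟨T, p', hp'⟩ : ∃ T p', β' ++ [u'] = p' :: T :=
    ⟨_, _, (List.cons_head_tail (by simp)).symm⟩
  set Λ' := (Λ \ β.toFinset) \ β'.toFinset with hΛ'
  have hpΛ' : p ∉ Λ' := notMem_sdiff_of_cons_eq_concat β' hu hp
  have hp'Λ' : p' ∉ Λ' := notMem_sdiff_of_concat_eq_cons β hu' hp'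
  have hc₁Λ' : c₁ ∈ Λ' := γ₀.mem_sdiff_of_mem_mid hdec (List.mem_of_head? hh₀)
  have hc₂Λ' : c₂ ∈ Λ' := γ₀.mem_sdiff_of_mem_mid hdec (List.mem_of_getLast? hl₀)
  have hpc : hexGraph.Adj p c₁ := γ₀.rel_door_head γ₀.isChain rfl hu huc hdec hh₀ hp
  have hp'c : hexGraph.Adj p' c₂ :=
    (γ₀.rel_getLast_door γ₀.isChain rfl hu' huc'.symm hdec hl₀ hp').symm
  have hm := γ₀.door_ne_door rfl rfl hu hu' hdec hh₀ hl₀ hp hp'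
  have hpout : r₁ < dist (hexCenter p) y := by
    rcases List.mem_cons.1 (show p ∈ u :: β by rw [hp]; simp) with rfl | h
    exacts [hyu, hβ p h]
  have hp'out : r₁ < dist (hexCenter p') y := by
    rcases List.mem_append.1 (show p' ∈ β' ++ [u'] by rw [hp']; simp) with h | h
    exacts [hβ' p' h, (List.mem_singleton.1 h).symm ▸ hyu']
  have hc₁far : R - 1 ≤ dist (hexCenter c₁) y := by
    linarith [dist_hexCenter_le_one_of_adj hpc.symm, dist_triangle (hexCenter p) (hexCenter c₁) y]
  have hc₂far : R - 1 ≤ dist (hexCenter c₂) y := by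
    linarith [dist_hexCenter_le_one_of_adj hp'c.symm,
      dist_triangle (hexCenter p') (hexCenter c₂) y]
  have hsub : Λ' ⊆ Λ := Finset.sdiff_subset.trans Finset.sdiff_subset
  have hV' : IsVirgin H Λ' y r₁ := by
    refine ⟨fun v hv => ?_, hV.adj⟩
    simp only [hΛ', Finset.mem_sdiff, List.mem_toFinset]
    exact ⟨⟨hV.mem v hv, fun h => absurd (hβ v h) (not_lt.2 hv.le)⟩,
      fun h => absurd (hβ' v h) (not_lt.2 hv.le)⟩
  have hSm : Straddles Λ' y r₁ s(p, c₁) := ⟨p, c₁, rfl, hpc, hpΛ', hc₁Λ', hc₁, hpout⟩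
  have hSm' : Straddles Λ' y r₁ s(p', c₂) := ⟨p', c₂, rfl, hp'c, hp'Λ', hc₂Λ', hc₂, hp'out⟩
  have hq' := hrec Λ' _ _ hsub hV' hSm hSm'
  have hk : 0 ≤ hexCriticalFugacity ^ (β.length + β'.length) :=
    pow_nonneg hexCriticalFugacity_pos_lt_one.1.le _
  have hlen : ∀ α : List HexVertex, hexCriticalFugacity ^ (β ++ α ++ β').length =
      hexCriticalFugacity ^ (β.length + β'.length) * hexCriticalFugacity ^ α.length := by
    intro α
    rw [List.length_append, List.length_append, ← pow_add]
    congr 1; omega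
  have e₂ : ∑ γ ∈ A, (if (arcCurve γ).HasTraversals k y ρ R then hexCriticalFugacity ^ γ.length
      else 0) = ∑ δ : HexMidEdgeSAW Λ' s(p, c₁) s(p', c₂), if IsHArc H δ then
        (if (⟨polyline (hexMidpoint s(u, c) :: (β ++ δ.verts ++ β').map hexCenter ++
            [hexMidpoint s(u', c')])⟩ : Curve ℂ).HasTraversals k y ρ R then
          hexCriticalFugacity ^ (β ++ δ.verts ++ β').length else 0) else 0 :=
    diveRecursion_fiber_sum_eq hu hu' γ₀ h₀ hdec hh₀ hl₀ hp hp' hpc A hA fun L =>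
      if (⟨polyline (hexMidpoint s(u, c) :: L.map hexCenter ++ [hexMidpoint s(u', c')])⟩ :
        Curve ℂ).HasTraversals k y ρ R then hexCriticalFugacity ^ L.length else 0
  have e₁ : ∑ γ ∈ A, hexCriticalFugacity ^ γ.length =
      hexCriticalFugacity ^ (β.length + β'.length) * arcMass H Λ' s(p, c₁) s(p', c₂) := by
    rw [arcMass, Finset.mul_sum]
    refine (diveRecursion_fiber_sum_eq hu hu' γ₀ h₀ hdec hh₀ hl₀ hp hp' hpc A hA (fun L =>
      hexCriticalFugacity ^ L.length)).trans ?_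
    refine Finset.sum_congr rfl fun δ _ => ?_
    split_ifs
    exacts [by rw [hlen]; rfl, (mul_zero _).symm]
  rw [e₂, e₁]
  refine le_trans ?_ ((mul_le_mul_of_nonneg_left hq' hk).trans_eq (by ring))
  rw [travMass, Finset.mul_sum]
  refine Finset.sum_le_sum fun δ _ => ?_
  by_cases hH : IsHArc H δ
  · rw [if_pos hH]
    by_cases ht : (⟨polyline (hexMidpoint s(u, c) :: (β ++ δ.verts ++ β').map hexCenter ++
        [hexMidpoint s(u', c')])⟩ : Curve ℂ).HasTraversals k y ρ R
    · obtain ⟨γ, -, hγv⟩ := γ₀.exists_glue rfl rfl hu hu' h₀ hdec hh₀ hl₀ hp hp' δ hH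
      obtain ⟨hh, hl⟩ := HexMidEdgeSAW.head?_getLast?_of_doors hpΛ' hp'Λ' hm δ
      have hγt : (arcCurve γ).HasTraversals k y ρ R := by
        change (⟨polyline (hexMidpoint s(u, c) :: γ.verts.map hexCenter ++
          [hexMidpoint s(u', c')])⟩ : Curve ℂ).HasTraversals k y ρ R
        rw [hγv]; exact ht
      have ht' : (arcCurve δ).HasTraversals k y (ρ + 2) (R - 2) :=
        hasTraversals_cut hVC γ δ hγv hh hl hu hu' huc huc' hρR hRr hyu hyu' hβ hβ' hc₁far
          hc₂far hγt
      rw [if_pos ht, if_pos ⟨hH, ht'⟩, hlen]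
      exact le_rfl
    · rw [if_neg ht]
      refine mul_nonneg hk ?_
      split_ifs; exacts [pow_nonneg hexCriticalFugacity_pos_lt_one.1.le _, le_rfl]
  · rw [if_neg hH, if_neg (fun h => hH h.1), mul_zero]

/-! ### The registered stub -/

/-- **stub B — TRAVERSAL LOCALIZATION** (`= VertexToCurve → TravLocalization` of the line
`reversal-virgin-disc`). Assume `VertexToCurve`. `(H, Λ₀)` virgin at radius `r₁` about any centre
`y`; arc class between the mid-edges `{u, c}`, `{u', c'}`, `u, u' ∉ Λ₀` lattice-adjacent to
`c, c'` and strictly outside the `r₁`-circle; `0 ≤ ρ`, `ρ + 4 < R`, `R + 2 ≤ r₁`, `k ≥ 1`,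
`θ ≥ 0`. If every virgin sub-configuration `(H, Λ' ⊆ Λ₀)` at `(y, r₁)` with doors `m, m'` has
`k`-traversal ratio `≤ θ` for `D(y; ρ + 2, R - 2)`, then the class has `k`-traversal ratio `≤ θ`
for `D(y; ρ, R)`. Proof: arcs with the event have a vertex in `B̄(y, r₁)`
(`exists_mem_verts_of_hasTraversals`); group them as in `stub_diveRecursion`
(`exists_split_first_last`, `split_first_last_eq`, `split_first_last_iff`); bound each group by
`travLocalization_fiber_bound`; sum over the groups (`Finset.sum_fiberwise_of_maps_to`). -/
theorem stub_travLocalization :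
    (∀ (l : List ℂ) (k : ℕ) (x : ℂ) (r r' R' R : ℝ), r < r' → r' < R' → R' < R →
      (∃ ι κ : Fin k → Fin l.length, (∀ m, ι m ≤ κ m) ∧
        (∀ m, (dist (l.get (ι m)) x ≤ r ∧ R ≤ dist (l.get (κ m)) x) ∨
          (R ≤ dist (l.get (ι m)) x ∧ dist (l.get (κ m)) x ≤ r)) ∧
        ∀ ⦃m m'⦄, m < m' → κ m ≤ ι m') →
      (⟨polyline l⟩ : Curve ℂ).HasTraversals k x r' R') →
    ∀ (H : SimpleGraph HexVertex) (Λ₀ : Finset HexVertex) (y : ℂ) (r₁ ρ R θ : ℝ) (k : ℕ)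
      (u c u' c' : HexVertex),
      1 ≤ k → 0 ≤ θ → 0 ≤ ρ → ρ + 4 < R → R + 2 ≤ r₁ →
      u ∉ Λ₀ → u' ∉ Λ₀ → hexGraph.Adj u c → hexGraph.Adj u' c' →
      r₁ < dist (hexCenter u) y → r₁ < dist (hexCenter u') y →
      IsVirgin H Λ₀ y r₁ →
      (∀ (Λ' : Finset HexVertex) (m m' : Sym2 HexVertex), Λ' ⊆ Λ₀ →
          IsVirgin H Λ' y r₁ → Straddles Λ' y r₁ m → Straddles Λ' y r₁ m' →
          travMass H Λ' m m' k y (ρ + 2) (R - 2) ≤ θ * arcMass H Λ' m m') →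
      travMass H Λ₀ s(u, c) s(u', c') k y ρ R ≤ θ * arcMass H Λ₀ s(u, c) s(u', c') := by
  intro hVC H Λ y r₁ ρ R θ k u c u' c' hk hθ _ hρR hRr hu hu' huc huc' hyu hyu' hV hrec
  -- the outside predicate and the group index
  set out : HexVertex → Bool := fun v => decide (r₁ < dist (hexCenter v) y) with hout
  have hout_false : ∀ v, out v = false ↔ dist (hexCenter v) y ≤ r₁ := fun v => by
    simp [hout, not_lt]
  have hout_true : ∀ v, out v = true ↔ r₁ < dist (hexCenter v) y := fun v => by simp [hout]
  set idx : HexMidEdgeSAW Λ s(u, c) s(u', c') →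
      List HexVertex × Option HexVertex × Option HexVertex × List HexVertex :=
    fun γ => (γ.verts.takeWhile out, (γ.verts.dropWhile out).head?,
      (γ.verts.reverse.dropWhile out).head?, (γ.verts.reverse.takeWhile out).reverse) with hidx
  set S : Finset (HexMidEdgeSAW Λ s(u, c) s(u', c')) :=
    Finset.univ.filter (fun γ => IsHArc H γ ∧ ∃ v ∈ γ.verts, dist (hexCenter v) y ≤ r₁) with hS
  have hmemS : ∀ γ, γ ∈ S ↔ IsHArc H γ ∧ ∃ v ∈ γ.verts, dist (hexCenter v) y ≤ r₁ := fun γ => by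
    rw [hS, Finset.mem_filter]; simp only [Finset.mem_univ, true_and]
  -- the traversal mass lives on `S`, the arc mass dominates the mass of `S`
  have hT : travMass H Λ s(u, c) s(u', c') k y ρ R = ∑ γ ∈ S,
      if (arcCurve γ).HasTraversals k y ρ R then hexCriticalFugacity ^ γ.length else 0 := by
    unfold travMass
    rw [hS, Finset.sum_filter]
    refine Finset.sum_congr rfl fun γ _ => ?_
    by_cases hA : IsHArc H γ ∧ (arcCurve γ).HasTraversals k y ρ R
    · rw [if_pos hA, if_pos hA.2, if_pos ⟨hA.1,
        exists_mem_verts_of_hasTraversals γ hu hu' huc huc' hk hρR hRr hyu hyu' hA.2⟩]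
    · rw [if_neg hA]
      by_cases h₁ : IsHArc H γ ∧ ∃ v ∈ γ.verts, dist (hexCenter v) y ≤ r₁
      · rw [if_pos h₁, if_neg fun h => hA ⟨h₁.1, h⟩]
      · rw [if_neg h₁]
  have hM : θ * ∑ γ ∈ S, hexCriticalFugacity ^ γ.length ≤ θ * arcMass H Λ s(u, c) s(u', c') := by
    refine mul_le_mul_of_nonneg_left ?_ hθ
    unfold arcMass
    rw [hS, Finset.sum_filter]
    refine Finset.sum_le_sum fun γ _ => ?_
    by_cases hA : IsHArc H γ ∧ ∃ v ∈ γ.verts, dist (hexCenter v) y ≤ r₁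
    · rw [if_pos hA, if_pos hA.1]
    · rw [if_neg hA]
      split_ifs; exacts [pow_nonneg hexCriticalFugacity_pos_lt_one.1.le _, le_rfl]
  refine hT.trans_le (le_trans ?_ hM)
  -- group by the index and bound each group
  have hmaps : ∀ γ ∈ S, idx γ ∈ S.image idx := fun γ hγ => Finset.mem_image_of_mem idx hγ
  rw [← Finset.sum_fiberwise_of_maps_to hmaps, ← Finset.sum_fiberwise_of_maps_to hmaps,
    Finset.mul_sum]
  refine Finset.sum_le_sum fun g hg => ?_
  obtain ⟨γ₀, hγ₀, rfl⟩ := Finset.mem_image.1 hg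
  obtain ⟨h₀, v₀, hv₀, hv₀r⟩ := (hmemS γ₀).1 hγ₀
  obtain ⟨β, α₀, β', c₁, c₂, hdec, hh₀, hl₀, hc₁, hc₂, hβ, hβ'⟩ :=
    exists_split_first_last out (L := γ₀.verts) ⟨v₀, hv₀, (hout_false v₀).2 hv₀r⟩
  obtain ⟨f1, f2, f3, f4⟩ := split_first_last_eq out hh₀ hl₀ hc₁ hc₂ hβ hβ'
  have hidx₀ : idx γ₀ = (β, some c₁, some c₂, β') := by simp only [hidx, hdec, f1, f2, f3, f4]
  refine travLocalization_fiber_bound hVC hρR hRr hV huc hu hyu huc' hu' hyu' hrec γ₀ h₀ hdec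
    hh₀ hl₀ ((hout_false _).1 hc₁) ((hout_false _).1 hc₂) (fun v hv => (hout_true v).1 (hβ v hv))
    (fun v hv => (hout_true v).1 (hβ' v hv)) _ fun γ => ?_
  rw [Finset.mem_filter, hmemS, hidx₀, and_assoc]
  refine and_congr_right fun _ => ?_
  rw [← split_first_last_iff out hc₁ hc₂ hβ hβ']
  simp only [hidx, Prod.mk.injEq, hout_false]

end Summit.CriticalPhenomena.SAWScalingLimit.Theorems.HexTight.Reversal

end
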